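import Literature.Computability.QuantumComplexity.GluedTreesThm9Graph

/-!
# `WbwObfuscatedGluedTrees` (stmt-QuantumAdvantage-2340) — III: layer information kills (depth leak, altimeter, squares)

Support / negative lemmas for the INFORMAL crux `WbwObfuscatedGluedTrees` of route
`Summits/QuantumAdvantage/QuantumAdvantage/Theses/WhiteBoxWalk`, extracted from the refuter work file
`Summits/QuantumAdvantage/QuantumAdvantage/Cruxes/WbwObfuscatedGluedTrees/Disproof.lean` (§1b of
cycle 1, §1c–§1d of cycle 2; refuter-cdisprove-stmt-QuantumAdvantage-2340-g2-0). Sequel of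
`LoadBearing.lean` (I) and `GrowthClosure.lean` (II), but self-contained: it imports only the tree's
glued-trees graph API (`GluedTreesThm9Graph`). Sorry-free; no Theses decl is asserted; pure graph
theory on `GluedTrees.graph n σ` (ChildsEtAl2003 §2). The `σ₀`-specific half of §1d (the structured
cycle is broken) is the sequel `StructuredCycle.lean` (IV), which imports this file.

All sections are LOAD-BEARING ANALYSES of the informal crux ("sub-exponentially secure iO +
puncturable PRF + injective OWF ⇒ clause (C) of `WbwThesis` for the obfuscated glued-trees
generator"): each exhibits a piece of information which, if computable from the names handed out by
the (obfuscated) neighbour circuit, lets a classical walker reach EXIT in `poly(n)` evaluations with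
probability `1`, so the typed generator / every hybrid of a proof must keep it hidden.

* `DepthLeak` (§1b): the parent is the UNIQUE strictly shallower neighbour
  (`eq_parentV_of_adj_of_depth_lt`), so a depth COMPARISON between adjacent names gives the role
  walk of `LoadBearing.lean`'s `RoleOrder` (`roleWalk_eq_exit`: EXIT in `2n+1` moves).
* `Altimeter` (§1c): weaker leak, same effect — if ONE complete layer `m` is weakly recognisable
  (`{depth = m, side of x} ⊆ R ⊆ {depth ≥ m-1}`), then at a vertex entered from a known child the
  parent is told from the other child by ONE arbitrary non-backtracking walk of `m - j - 1` steps: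
  from a child every such walk is forced down and ends at depth exactly `m` (`forced_descent`,
  `child_walk_end`); from the parent depth is 1-Lipschitz, so it ends at depth `≤ m - 2`
  (`depth_walk_le`, `parent_walk_end`); `altimeter` is the dichotomy. EXIT in `O(n²)` evaluations.
  (Crux ideator 2's "altimeter lemma" B2, `Cruxes/WbwObfuscatedGluedTrees/BARRIER-NOTES-ideator2.md`,
  made formal.)
* `Squares` (§1d, general half): `OnSquare G v` (`v` lies on a 4-cycle; decided with 4 evaluations
  of the neighbour map on canonical names) fails at every vertex of depth `≤ n - 2` for EVERY cycle
  datum (`not_onSquare_of_depth_add_two_le`: the radius-2 ball is a tree). So WHENEVER the glue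
  creates squares at the bottom (as the structured datum `σ₀ = (id, id)` does at every bottom vertex,
  sequel IV), `OnSquare` is a recogniser for layer `n - 1` in the sense of `Altimeter.altimeter`.
-/

set_option linter.dupNamespace false

namespace Summit.QuantumAdvantage.QuantumAdvantage.Theorems.WbwObfuscatedGluedTrees.Negative

open Literature.Computability.QuantumComplexity

/-! ## §1b Load-bearing hypothesis: names must hide the DEPTH order of adjacent vertices

If anything efficiently computable from two adjacent names decides which vertex is shallower, the
adversary climbs: at a non-root vertex the parent is the UNIQUE strictly shallower neighbour, so
"go down `n` times, cross once, then repeatedly move to the shallower neighbour" is the role walk of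
`LoadBearing.lean` (`RoleOrder.roleWalk_eq_exit`) and ends at EXIT after `2n+1` moves. -/

namespace DepthLeak

open GluedTrees

variable {n : ℕ}

/-- **The parent is the unique strictly shallower neighbour** of any vertex of `G'_n(σ)` (`1 ≤ n`):
children are deeper, cross neighbours of a leaf are leaves of the same depth. [folklore] -/
theorem eq_parentV_of_adj_of_depth_lt (hn : 1 ≤ n) (σ : CycleDatum n) {v w : Vertex n}
    (hadj : (graph n σ).Adj v w) (hlt : depth w < depth v) : w = parentV v := by
  by_cases hv : depth v < n
  · rw [← SimpleGraph.mem_neighborFinset, neighborFinset_of_depth_lt σ hv] at hadj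
    simp only [Finset.mem_union, Finset.mem_insert, Finset.mem_singleton] at hadj
    rcases hadj with h | h | h
    · split_ifs at h with h0
      · simp at h
      · simpa using h
    · exfalso
      have := congrArg depth h
      rw [depth_childV hv] at this
      omega
    · exfalso
      have := congrArg depth h
      rw [depth_childV hv] at this
      omega
  · have hv' : depth v = n := le_antisymm (depth_le v) (not_lt.mp hv)
    obtain ⟨i, rfl | rfl⟩ := exists_eq_leaf hv'
    · rw [← SimpleGraph.mem_neighborFinset, neighborFinset_leafL hn] at hadj
      simp only [Finset.mem_insert, Finset.mem_singleton] at hadj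
      rcases hadj with h | h | h
      · exact h
      · exfalso; rw [h] at hlt; simp at hlt
      · exfalso; rw [h] at hlt; simp at hlt
    · rw [← SimpleGraph.mem_neighborFinset, neighborFinset_leafR hn] at hadj
      simp only [Finset.mem_insert, Finset.mem_singleton] at hadj
      rcases hadj with h | h | h
      · exact h
      · exfalso; rw [h] at hlt; simp at hlt
      · exfalso; rw [h] at hlt; simp at hlt

/-- Conversely the parent IS strictly shallower (non-root vertex), so a depth-comparison oracle on
names singles it out among the `≤ 3` neighbours. [folklore] -/
theorem depth_parentV_lt {v : Vertex n} (hv : 1 ≤ depth v) : depth (parentV v) < depth v := by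
  rw [depth_parentV]; omega

end DepthLeak

/-! ## §1c Load-bearing hypothesis: NO complete layer of the trees may be recognisable (altimeter)

Suppose some efficiently decidable predicate `R` on names recognises ONE layer `m` below the current
vertex in the weak sense `{depth = m, same side} ⊆ R ⊆ {depth ≥ m - 1}` (a visible level tag; a
level-`m` key that can be told apart; the glue squares of §1d with `m = n - 1`; for a key-holding
REDUCTION, any layer whose naming key it owns). Then at a vertex `x` of depth `1 ≤ j < m` entered
from a KNOWN child, the two other neighbours `y` are told apart by ONE arbitrary non-backtracking
walk of `m - j - 1` further steps from `y` avoiding `x`: from the child the walk is FORCED downwards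
and ends at depth exactly `m`, from the parent it ends at depth `≤ m - 2`. Iterating from a right
leaf (reached by `n` remembered down-steps and one glued edge) identifies the parent at every level
at a cost of `≤ 2(m - j) + O(1)` evaluations: EXIT in `O(n²)` evaluations with probability `1`. -/

namespace Altimeter

open GluedTrees

variable {n : ℕ}

/-- Depth is 1-Lipschitz along the edges of `G'_n(σ)` (tree edges change it by one, glued edges
join two leaves). [folklore] -/
theorem depth_le_of_adj (σ : CycleDatum n) {u v : Vertex n} (h : (graph n σ).Adj u v) :
    depth v ≤ depth u + 1 ∧ depth u ≤ depth v + 1 := by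
  rw [graph_adj] at h
  obtain ⟨-, (hc | hg) | (hc | hg)⟩ := h
  · obtain ⟨-, hd, -⟩ := isChild_iff.mp hc
    exact ⟨by omega, by omega⟩
  · obtain ⟨h1, h2⟩ := depth_eq_of_isGlued hg
    exact ⟨by omega, by omega⟩
  · obtain ⟨-, hd, -⟩ := isChild_iff.mp hc
    exact ⟨by omega, by omega⟩
  · obtain ⟨h1, h2⟩ := depth_eq_of_isGlued hg
    exact ⟨by omega, by omega⟩

/-- An edge with a non-leaf endpoint is a tree edge: it keeps the side. [folklore] -/
theorem fst_eq_of_adj (σ : CycleDatum n) {u v : Vertex n} (h : (graph n σ).Adj u v)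
    (hu : depth u < n) : u.1 = v.1 := by
  rw [graph_adj] at h
  obtain ⟨-, (hc | hg) | (hc | hg)⟩ := h
  · exact (isChild_iff.mp hc).1
  · have := (depth_eq_of_isGlued hg).1; omega
  · exact (isChild_iff.mp hc).1.symm
  · have := (depth_eq_of_isGlued hg).2; omega

/-- **Lemma B (any walk)**: after `k` steps along edges the depth has grown by at most `k`. [folklore] -/
theorem depth_walk_le (σ : CycleDatum n) (w : ℕ → Vertex n) (i₀ : ℕ) :
    ∀ k, (∀ i, i₀ ≤ i → i < i₀ + k → (graph n σ).Adj (w i) (w (i + 1))) →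
      depth (w (i₀ + k)) ≤ depth (w i₀) + k := by
  intro k
  induction k with
  | zero => intro _; simp
  | succ k ih =>
    intro hadj
    have h1 : depth (w (i₀ + k)) ≤ depth (w i₀) + k :=
      ih fun i hi hik => hadj i hi (by omega)
    have h2 := (depth_le_of_adj σ (hadj (i₀ + k) (by omega) (by omega))).1
    rw [show i₀ + (k + 1) = i₀ + k + 1 by omega]
    omega

/-- A neighbour of an inner vertex other than its parent is one of its two children. [folklore] -/
theorem eq_childV_of_adj_of_ne_parentV (σ : CycleDatum n) {v u : Vertex n} (hv : depth v < n)
    (hadj : (graph n σ).Adj v u) (hne : u ≠ parentV v) : ∃ b, u = childV v b := by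
  rw [← SimpleGraph.mem_neighborFinset, neighborFinset_of_depth_lt σ hv] at hadj
  simp only [Finset.mem_union, Finset.mem_insert, Finset.mem_singleton] at hadj
  rcases hadj with h | h | h
  · split_ifs at h with h0
    · simp at h
    · simp only [Finset.mem_singleton] at h
      exact absurd h hne
  · exact ⟨false, h⟩
  · exact ⟨true, h⟩

/-- **Lemma A (forced descent)**: a non-backtracking walk `x = w 0, w 1 = child of x, w 2, …` whose
steps are edges goes DOWN at every step while it is above the leaves: `w i` has depth `depth x + i`,
its predecessor is its parent, and it stays on the side of `x`. [folklore] -/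
theorem forced_descent (σ : CycleDatum n) {K : ℕ} (w : ℕ → Vertex n) {x : Vertex n} {b : Bool}
    (hx : depth x < n) (h0 : w 0 = x) (h1 : w 1 = childV x b)
    (hadj : ∀ i, i < K → (graph n σ).Adj (w i) (w (i + 1)))
    (hnb : ∀ i, i + 2 ≤ K → w (i + 2) ≠ w i) :
    ∀ i, 1 ≤ i → i ≤ K → depth x + i ≤ n →
      depth (w i) = depth x + i ∧ parentV (w i) = w (i - 1) ∧ (w i).1 = x.1 := by
  intro i
  induction i with
  | zero => intro h; omega
  | succ i ih =>
    intro _ hiK hin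
    rcases Nat.eq_zero_or_pos i with rfl | hipos
    · refine ⟨?_, ?_, ?_⟩
      · rw [zero_add, h1, depth_childV hx]
      · rw [zero_add, h1, parentV_childV hx, Nat.sub_self, h0]
      · rw [zero_add, h1, childV_fst]
    · obtain ⟨hd, hp, hs⟩ := ih hipos (by omega) (by omega)
      have hlt : depth (w i) < n := by omega
      have hne : w (i + 1) ≠ parentV (w i) := by
        rw [hp]
        have := hnb (i - 1) (by omega)
        rwa [show i - 1 + 2 = i + 1 by omega] at this
      obtain ⟨b', hb'⟩ := eq_childV_of_adj_of_ne_parentV σ hlt (hadj i (by omega)) hne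
      refine ⟨?_, ?_, ?_⟩
      · rw [hb', depth_childV hlt, hd, Nat.add_assoc]
      · rw [hb', parentV_childV hlt, Nat.add_sub_cancel]
      · rw [hb', childV_fst, hs]

/-- **From the other child the walk ends ON layer `m`** (same side as `x`): `K = m - depth x`
edges from `x` through the child. [folklore] -/
theorem child_walk_end (σ : CycleDatum n) {m : ℕ} (hm : m ≤ n) (w : ℕ → Vertex n) {x : Vertex n}
    {b : Bool} (hxm : depth x < m) (h0 : w 0 = x) (h1 : w 1 = childV x b)
    (hadj : ∀ i, i < m - depth x → (graph n σ).Adj (w i) (w (i + 1)))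
    (hnb : ∀ i, i + 2 ≤ m - depth x → w (i + 2) ≠ w i) :
    depth (w (m - depth x)) = m ∧ (w (m - depth x)).1 = x.1 := by
  obtain ⟨hd, -, hs⟩ := forced_descent σ w (by omega) h0 h1 hadj hnb (m - depth x)
    (by omega) le_rfl (by omega)
  exact ⟨by omega, hs⟩

/-- **From the parent the walk ends at depth `≤ m - 2`**, whatever it does. [folklore] -/
theorem parent_walk_end (σ : CycleDatum n) {m : ℕ} (w : ℕ → Vertex n) {x : Vertex n}
    (hx : 1 ≤ depth x) (hxm : depth x < m) (h1 : w 1 = parentV x)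
    (hadj : ∀ i, i < m - depth x → (graph n σ).Adj (w i) (w (i + 1))) :
    depth (w (m - depth x)) + 2 ≤ m := by
  have h := depth_walk_le σ w 1 (m - depth x - 1) fun i hi hik => hadj i (by omega)
  rw [show 1 + (m - depth x - 1) = m - depth x by omega, h1, depth_parentV] at h
  omega

/-- **The altimeter.** `R` recognises layer `m` weakly (`{depth = m on the side of x} ⊆ R ⊆
{depth ≥ m - 1}`); `x` has depth `1 ≤ j < m ≤ n`; `w` is any walk `x = w 0, w 1 = y, …, w (m - j)`
along edges, non-backtracking (in particular `w 2 ≠ x`). If `y` is a child the end vertex is in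
`R`; if `y` is the parent it is not. One walk per candidate identifies the parent. [folklore] -/
theorem altimeter (σ : CycleDatum n) {m : ℕ} (hm : m ≤ n) (R : Set (Vertex n)) {x : Vertex n}
    (hR₁ : ∀ v, depth v = m → v.1 = x.1 → v ∈ R) (hR₂ : ∀ v ∈ R, m ≤ depth v + 1)
    (hx : 1 ≤ depth x) (hxm : depth x < m) (w : ℕ → Vertex n) (h0 : w 0 = x)
    (hadj : ∀ i, i < m - depth x → (graph n σ).Adj (w i) (w (i + 1)))
    (hnb : ∀ i, i + 2 ≤ m - depth x → w (i + 2) ≠ w i) :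
    ((∃ b, w 1 = childV x b) → w (m - depth x) ∈ R) ∧
      (w 1 = parentV x → w (m - depth x) ∉ R) := by
  constructor
  · rintro ⟨b, h1⟩
    obtain ⟨hd, hs⟩ := child_walk_end σ hm w hxm h0 h1 hadj hnb
    exact hR₁ _ hd hs
  · intro h1 hmem
    have h := parent_walk_end σ w hx hxm h1 hadj
    have h' := hR₂ _ hmem
    omega

/-- The neighbours of an inner vertex ARE its parent (absent at a root) and its two children, so
the altimeter's dichotomy is exhaustive. [folklore] -/
theorem adj_cases (σ : CycleDatum n) {x y : Vertex n} (hx : depth x < n)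
    (h : (graph n σ).Adj x y) : (depth x ≠ 0 ∧ y = parentV x) ∨ ∃ b, y = childV x b := by
  rw [← SimpleGraph.mem_neighborFinset, neighborFinset_of_depth_lt σ hx] at h
  simp only [Finset.mem_union, Finset.mem_insert, Finset.mem_singleton] at h
  rcases h with h | h | h
  · split_ifs at h with h0
    · simp at h
    · simp only [Finset.mem_singleton] at h
      exact Or.inl ⟨h0, h⟩
  · exact Or.inr ⟨false, h⟩
  · exact Or.inr ⟨true, h⟩

end Altimeter

/-! ## §1d (general half) Squares through the glue: none above the bottom two layers, for every `σ`

`OnSquare v` is a name-level test (4 evaluations). For EVERY cycle datum the radius-2 ball of a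
vertex of depth `≤ n - 2` is a tree, so the test fails there; a cycle datum whose glue puts the
bottom layers on squares (e.g. `σ₀ = (id, id)`, sequel IV) therefore hands the adversary a
recogniser `R = OnSquare` with `R ⊆ {depth ≥ n - 1}`, to be fed to `Altimeter.altimeter`. -/

namespace Squares

open GluedTrees

variable {n : ℕ}

/-- `v` lies on a 4-cycle `v — z₁ — w — z₂ — v` of `G`. Decidable at name level with `4`
evaluations of the neighbour map (names are canonical). [folklore] -/
def OnSquare {V : Type*} (G : SimpleGraph V) (v : V) : Prop :=
  ∃ z₁ z₂ w : V, G.Adj v z₁ ∧ G.Adj v z₂ ∧ z₁ ≠ z₂ ∧ w ≠ v ∧ G.Adj z₁ w ∧ G.Adj z₂ w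

/-- **No squares above the bottom two layers, for EVERY cycle datum**: a vertex of depth
`≤ n - 2` lies on no 4-cycle (its radius-2 ball is a tree). [folklore] -/
theorem not_onSquare_of_depth_add_two_le (σ : CycleDatum n) {v : Vertex n} (hv : depth v + 2 ≤ n) :
    ¬ OnSquare (graph n σ) v := by
  rintro ⟨z₁, z₂, w, h1, h2, hne, hwv, hw1, hw2⟩
  have hvn : depth v < n := by omega
  -- through a child `z` of `v`, the far vertex `w ≠ v` is a grandchild: `parentV w = z`
  have hchild : ∀ (z : Vertex n) (b : Bool), z = childV v b → (graph n σ).Adj z w → parentV w = z := by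
    intro z b hz hzw
    have hz' : depth z < n := by rw [hz, depth_childV hvn]; omega
    have hwne : w ≠ parentV z := by rw [hz, parentV_childV hvn]; exact hwv
    obtain ⟨b', hb'⟩ := Altimeter.eq_childV_of_adj_of_ne_parentV σ hz' hzw hwne
    rw [hb', parentV_childV hz']
  have hchild_depth : ∀ (z : Vertex n) (b : Bool), z = childV v b → (graph n σ).Adj z w →
      depth w = depth v + 2 := by
    intro z b hz hzw
    have hp := hchild z b hz hzw
    have hz' : depth z = depth v + 1 := by rw [hz, depth_childV hvn]
    have := congrArg depth hp
    rw [depth_parentV, hz'] at this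
    have hw1 := (Altimeter.depth_le_of_adj σ hzw).1
    omega
  -- through the parent, `w` has depth `≤ depth v`
  have hpar : ∀ z : Vertex n, depth v ≠ 0 → z = parentV v → (graph n σ).Adj z w →
      depth w ≤ depth v := by
    intro z h0 hz hzw
    have := (Altimeter.depth_le_of_adj σ hzw).1
    rw [hz, depth_parentV] at this
    omega
  rcases Altimeter.adj_cases σ hvn h1 with ⟨h01, hz1⟩ | ⟨b₁, hz1⟩ <;>
    rcases Altimeter.adj_cases σ hvn h2 with ⟨h02, hz2⟩ | ⟨b₂, hz2⟩
  · exact hne (hz1.trans hz2.symm)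
  · have := hpar z₁ h01 hz1 hw1
    have := hchild_depth z₂ b₂ hz2 hw2
    omega
  · have := hpar z₂ h02 hz2 hw2
    have := hchild_depth z₁ b₁ hz1 hw1
    omega
  · have e1 := hchild z₁ b₁ hz1 hw1
    have e2 := hchild z₂ b₂ hz2 hw2
    exact hne (e1.symm.trans e2)

end Squares

end Summit.QuantumAdvantage.QuantumAdvantage.Theorems.WbwObfuscatedGluedTrees.Negative
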